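import Summits.QuantumFields.YangMills.Theorems.BalabanLadderIRPinnedExitCofinal
import HarnessLib

/-!
# Crux `BalabanLadder.IRcof` (stmt-QuantumFields-26930): THE NUMBER along a SEQUENCE of couplings — PXcof(θ) is «one pinned θ-pure cold
# box per coupling along some divergent scheme β_k → ∞» (equivalence helper; LEAD prover ym-ir-line-ab-p1 gen 6, slot custody)

HONEST STATUS.  Pure bookkeeping (choice); nothing here proves PXcof(1/24) (THE NUMBER), PX(1/24), `BalabanLadder.IRcof` (26930),
`BalabanLadder.IR` (19354) or the Clay Yang–Mills mass gap (R4 = the conditional finite-𝕋⁴ rung `BalabanLadder.UV` only).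

The registered sc stub of the 26930 slot of record is `stub_pinnedExitsCofinal : PinnedExitsCofinalAt (1/24)`, whose body (spelled below
verbatim, as in `PinnedExitCofinal.pinnedExitsCofinal_of_pinnedExitAt` and `IR/Negative/PinnedExitVacuityThreshold.lean`) reads
«∃ T, ∀ β₁, ∃ β ≥ β₁, ∃ L ≥ 8, a(β)·L ≤ T ∧ δᶜ_β(L) ≤ θ».  THIS FILE: that body is EQUIVALENT to its SEQUENTIAL form
«∃ T, ∃ b : ℕ → ℝ, b_k → ∞ ∧ ∀ k, ∃ L ≥ 8, a(b_k)·L ≤ T ∧ δᶜ_{b_k}(L) ≤ θ» — one pinned θ-pure cold 4:1 box per coupling along a divergent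
scheme, which is how the instrument rows of `pub/ym-ir/FINITE-BOX-PURITY.md` and the companion `IRcof_iff_seq`
(`BalabanLadderIRCofinalLeafSequenceForm`) phrase the deliverable.  `pinnedBoxes_cofinal_iff_seq` (per `(G, r, a)`),
`pinnedExitsCofinalAt_iff_seq` (the stub body, all binders).
-/

noncomputable section

open Filter Topology
open Literature.MathematicalPhysics.QuantumFieldTheory
open Summit.QuantumFields.YangMills.Cruxes.OSLegsFromFemtoAndGap.DlrCollarTransfer (LowerBounds)
open Summit.QuantumFields.YangMills.Cruxes.IR.ColdPurityBridge (coldDefect)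

namespace Summit.QuantumFields.YangMills.Cruxes.IR.PinnedExit96.Sequence

section Model

variable {G : Type} [Group G] [TopologicalSpace G] [IsTopologicalGroup G] [CompactSpace G]
  [MeasurableSpace G] [BorelSpace G]

/-- **Cofinal pinned boxes ⟺ pinned boxes along a divergent sequence** (per `(r, a, T, θ)`): «for every `β₁` some `β ≥ β₁` carries a pinned
`θ`-pure box» iff «some sequence `b_k → ∞` carries one pinned `θ`-pure box per `k`» (choose `b_k ≥ k`; conversely `b_k → ∞` passes every `β₁`). -/
theorem pinnedBoxes_cofinal_iff_seq (r : LatticeRep G) (a : ℝ → ℝ) (T θ : ℝ) :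
    (∀ β₁ : ℝ, ∃ β : ℝ, β₁ ≤ β ∧ ∃ L : ℕ, 8 ≤ L ∧ a β * (L : ℝ) ≤ T ∧ coldDefect r.ρ β L ≤ θ) ↔
      ∃ b : ℕ → ℝ, Tendsto b atTop atTop ∧ ∀ k : ℕ, ∃ L : ℕ, 8 ≤ L ∧ a (b k) * (L : ℝ) ≤ T ∧ coldDefect r.ρ (b k) L ≤ θ := by
  constructor
  · intro h
    choose b hbge hbox using fun k : ℕ => h (k : ℝ)
    exact ⟨b, tendsto_atTop_mono hbge tendsto_natCast_atTop_atTop, hbox⟩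
  · rintro ⟨b, hb, hbox⟩ β₁
    obtain ⟨k, hk⟩ := (hb.eventually (eventually_ge_atTop β₁)).exists
    exact ⟨b k, hk, hbox k⟩

end Model

/-- **PXcof(θ) IS its sequential form** (PROVED equivalence; the cofinal stub body of the 26930 slot of record, all binders verbatim):
THE NUMBER = «for every compact simple simply-connected `G`, `r`, positive unit map `a → 0` with the floor: a pin `T` and a divergent scheme
`β_k → ∞` with ONE `θ`-pure cold 4:1 box of side `8 ≤ L_k ≤ T/a(β_k)` per `k`». -/
theorem pinnedExitsCofinalAt_iff_seq (θ : ℝ) :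
    (∀ (G : Type) [Group G] [TopologicalSpace G] [IsTopologicalGroup G] [CompactSpace G],
      IsCompactSimpleLieGroup G → SimplyConnectedSpace G →
      letI : MeasurableSpace G := borel G
      haveI : BorelSpace G := ⟨rfl⟩
      ∀ (r : LatticeRep G) (a : ℝ → ℝ), (∀ β, 0 < a β) → Tendsto a atTop (𝓝 0) → LowerBounds G r a →
        ∃ T : ℝ, ∀ β₁ : ℝ, ∃ β : ℝ, β₁ ≤ β ∧ ∃ L : ℕ, 8 ≤ L ∧ a β * (L : ℝ) ≤ T ∧ coldDefect r.ρ β L ≤ θ) ↔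
    (∀ (G : Type) [Group G] [TopologicalSpace G] [IsTopologicalGroup G] [CompactSpace G],
      IsCompactSimpleLieGroup G → SimplyConnectedSpace G →
      letI : MeasurableSpace G := borel G
      haveI : BorelSpace G := ⟨rfl⟩
      ∀ (r : LatticeRep G) (a : ℝ → ℝ), (∀ β, 0 < a β) → Tendsto a atTop (𝓝 0) → LowerBounds G r a →
        ∃ (T : ℝ) (b : ℕ → ℝ), Tendsto b atTop atTop ∧
          ∀ k : ℕ, ∃ L : ℕ, 8 ≤ L ∧ a (b k) * (L : ℝ) ≤ T ∧ coldDefect r.ρ (b k) L ≤ θ) := by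
  constructor
  · intro h G _ _ _ _ hG hsc
    letI : MeasurableSpace G := borel G
    haveI : BorelSpace G := ⟨rfl⟩
    intro r a ha ha0 hlb
    obtain ⟨T, hT⟩ := h G hG hsc r a ha ha0 hlb
    obtain ⟨b, hb, hbox⟩ := (pinnedBoxes_cofinal_iff_seq r a T θ).1 hT
    exact ⟨T, b, hb, hbox⟩
  · intro h G _ _ _ _ hG hsc
    letI : MeasurableSpace G := borel G
    haveI : BorelSpace G := ⟨rfl⟩
    intro r a ha ha0 hlb
    obtain ⟨T, b, hb, hbox⟩ := h G hG hsc r a ha ha0 hlb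
    exact ⟨T, (pinnedBoxes_cofinal_iff_seq r a T θ).2 ⟨b, hb, hbox⟩⟩

end Summit.QuantumFields.YangMills.Cruxes.IR.PinnedExit96.Sequence

end
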